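import Mathlib
import HarnessLib

/-!
# `OneFlightGossipEngine.OneFlightLayeredChaos` — stub `bayes_tv_defect` of line `Sketch`
(crux stmt-AtomisticToContinuum-14535)

The finite skeleton of the Bayes / total-variation step of the idea card
`palm-inversion-past-insensitivity` (crux dir `Cruxes/OneFlightLayeredChaos/Ideas/`): for a prior `p` on the
kick variable `ω` (a probability vector), a weight `q` on everything else `y`, data `G ω y`, and a mark
functional `|f| ≤ 1` of the kick, the `ℓ¹(data)`-defect of `f` against its prior mean is at most twice the
`p ⊗ p`-average `ℓ¹`-distance between the data laws under `ω` and under `ω'`. Elementary (centring +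
triangle inequality); the weight `q` need not be normalised, nor — for the inequality — nonnegative.
-/

open scoped BigOperators

namespace Summit.AtomisticToContinuum.HydrodynamicLimit.Theorems

/-- **Bayes/TV defect bound (finite form).** With `p ≥ 0`, `∑ p = 1`, `|f| ≤ 1`, data map `G` and
weight `q`, writing `L ω d = ∑ y, q y · 1[G ω y = d]` for the (unnormalised) data law under `ω`:
`∑_d |∑_ω ∑_y p ω q y 1[G ω y = d] (f ω − p·f)| ≤ 2 ∑_ω ∑_ω' p ω p ω' ∑_d |L ω d − L ω' d|`.
Registered stub `bayes_tv_defect` of line `Sketch` (first lemma of card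
`palm-inversion-past-insensitivity`). [folklore] -/
theorem bayes_tv_defect {Ω Y D : Type*} [Fintype Ω] [Fintype Y] [Fintype D] [DecidableEq D]
    (p : Ω → ℝ) (q : Y → ℝ) (hp : ∀ ω, 0 ≤ p ω) (hq : ∀ y, 0 ≤ q y)
    (hp1 : ∑ ω, p ω = 1) (G : Ω → Y → D) (f : Ω → ℝ) (hf : ∀ ω, |f ω| ≤ 1) :
    ∑ d, |∑ ω, ∑ y, p ω * q y * (if G ω y = d then (1 : ℝ) else 0) * (f ω - ∑ ω', p ω' * f ω')|
      ≤ 2 * ∑ ω, ∑ ω', p ω * p ω' *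
          ∑ d, |(∑ y, q y * (if G ω y = d then (1 : ℝ) else 0))
                - (∑ y, q y * (if G ω' y = d then (1 : ℝ) else 0))| := by
  classical
  -- `q ≥ 0` is part of the registered signature; the inequality itself does not need it.
  have _hq0 : ∀ y, 0 ≤ q y := hq
  set fbar : ℝ := ∑ ω', p ω' * f ω' with hfbar
  set L : Ω → D → ℝ := fun ω d => ∑ y, q y * (if G ω y = d then (1 : ℝ) else 0) with hL
  -- |fbar| ≤ 1 and |f ω - fbar| ≤ 2
  have hfbar1 : |fbar| ≤ 1 := by
    calc |fbar| ≤ ∑ ω', |p ω' * f ω'| := Finset.abs_sum_le_sum_abs _ _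
      _ = ∑ ω', p ω' * |f ω'| := by
          refine Finset.sum_congr rfl fun ω' _ => ?_
          rw [abs_mul, abs_of_nonneg (hp ω')]
      _ ≤ ∑ ω', p ω' * 1 := by
          gcongr with ω' _
          · exact hp ω'
          · exact hf ω'
      _ = 1 := by rw [← Finset.sum_mul, hp1, one_mul]
  have hf2 : ∀ ω, |f ω - fbar| ≤ 2 := fun ω =>
    calc |f ω - fbar| ≤ |f ω| + |fbar| := abs_sub _ _
      _ ≤ 1 + 1 := add_le_add (hf ω) hfbar1
      _ = 2 := by norm_num
  -- centring
  have hcent : ∑ ω, p ω * (f ω - fbar) = 0 := by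
    have h1 : ∑ ω, p ω * (f ω - fbar) = (∑ ω, p ω * f ω) - (∑ ω, p ω) * fbar := by
      rw [Finset.sum_mul, ← Finset.sum_sub_distrib]
      refine Finset.sum_congr rfl fun ω _ => by ring
    rw [h1, hp1, one_mul, hfbar, sub_self]
  -- the per-datum bound
  have key : ∀ d, |∑ ω, ∑ y, p ω * q y * (if G ω y = d then (1 : ℝ) else 0) * (f ω - fbar)|
      ≤ 2 * ∑ ω, ∑ ω', p ω * p ω' * |L ω d - L ω' d| := by
    intro d
    set Lbar : ℝ := ∑ ω', p ω' * L ω' d with hLbar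
    have hinner : ∀ ω, ∑ y, p ω * q y * (if G ω y = d then (1 : ℝ) else 0) * (f ω - fbar)
        = p ω * (f ω - fbar) * L ω d := by
      intro ω
      rw [hL]
      simp only
      rw [Finset.mul_sum]
      exact Finset.sum_congr rfl fun y _ => by ring
    have hsum : ∑ ω, ∑ y, p ω * q y * (if G ω y = d then (1 : ℝ) else 0) * (f ω - fbar)
        = ∑ ω, p ω * (f ω - fbar) * (L ω d - Lbar) := by
      rw [Finset.sum_congr rfl fun ω _ => hinner ω]
      have h0 : ∑ ω, p ω * (f ω - fbar) * Lbar = 0 := by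
        rw [← Finset.sum_mul, hcent, zero_mul]
      rw [← sub_zero (∑ ω, p ω * (f ω - fbar) * L ω d), ← h0, ← Finset.sum_sub_distrib]
      exact Finset.sum_congr rfl fun ω _ => by ring
    have hLdiff : ∀ ω, |L ω d - Lbar| ≤ ∑ ω', p ω' * |L ω d - L ω' d| := by
      intro ω
      have h1 : L ω d - Lbar = ∑ ω', p ω' * (L ω d - L ω' d) := by
        simp only [mul_sub, Finset.sum_sub_distrib, hLbar]
        rw [← Finset.sum_mul, hp1, one_mul]
      rw [h1]
      calc |∑ ω', p ω' * (L ω d - L ω' d)| ≤ ∑ ω', |p ω' * (L ω d - L ω' d)| :=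
            Finset.abs_sum_le_sum_abs _ _
        _ = ∑ ω', p ω' * |L ω d - L ω' d| :=
            Finset.sum_congr rfl fun ω' _ => by rw [abs_mul, abs_of_nonneg (hp ω')]
    rw [hsum]
    calc |∑ ω, p ω * (f ω - fbar) * (L ω d - Lbar)|
        ≤ ∑ ω, |p ω * (f ω - fbar) * (L ω d - Lbar)| := Finset.abs_sum_le_sum_abs _ _
      _ = ∑ ω, p ω * |f ω - fbar| * |L ω d - Lbar| :=
          Finset.sum_congr rfl fun ω _ => by rw [abs_mul, abs_mul, abs_of_nonneg (hp ω)]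
      _ ≤ ∑ ω, p ω * 2 * ∑ ω', p ω' * |L ω d - L ω' d| :=
          Finset.sum_le_sum fun ω _ =>
            mul_le_mul (mul_le_mul_of_nonneg_left (hf2 ω) (hp ω)) (hLdiff ω) (abs_nonneg _)
              (mul_nonneg (hp ω) (by norm_num))
      _ = 2 * ∑ ω, ∑ ω', p ω * p ω' * |L ω d - L ω' d| := by
          rw [Finset.mul_sum]
          refine Finset.sum_congr rfl fun ω _ => ?_
          rw [Finset.mul_sum, Finset.mul_sum]
          exact Finset.sum_congr rfl fun ω' _ => by ring
  -- sum over the data and swap the sums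
  calc ∑ d, |∑ ω, ∑ y, p ω * q y * (if G ω y = d then (1 : ℝ) else 0) * (f ω - fbar)|
      ≤ ∑ d, 2 * ∑ ω, ∑ ω', p ω * p ω' * |L ω d - L ω' d| := Finset.sum_le_sum fun d _ => key d
    _ = 2 * ∑ ω, ∑ ω', p ω * p ω' * ∑ d, |L ω d - L ω' d| := by
        rw [← Finset.mul_sum, Finset.sum_comm]
        congr 1
        refine Finset.sum_congr rfl fun ω _ => ?_
        rw [Finset.sum_comm]
        refine Finset.sum_congr rfl fun ω' _ => ?_
        rw [Finset.mul_sum]
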